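import Literature.NumberTheory.Automorphic.QuadraticBaseChangeFrobCompatibleAuxFieldProofs
import Literature.NumberTheory.Automorphic.HilbertModularLocalGlobal
import Literature.NumberTheory.Automorphic.LocalComponentBJUnramifiedProofs
import Literature.NumberTheory.GaloisRepresentations.WeilDeligneOfGaloisUnramifiedProofs
import HarnessLib

/-!
# `Langlands1980_quadraticBaseChange_frobCompatible` from local–global compatibility in the
# Weil–Deligne form WITH the unramified clause of the local Langlands correspondence

Topic `Literature/NumberTheory/Automorphic`, proof file (theorems only, no definition, no named
fact), sibling of `QuadraticBaseChangeFrobCompatible{,Proofs,CarayolProofs,AuxFieldProofs,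
SplitAuxFieldProofs}` and of `HilbertModularLocalGlobal` (the named fact
`galoisRep_GL2_totallyReal_localGlobal`: Carayol–Taylor–Blasius–Rogawski–Saito–Skinner
local–global compatibility at every finite place for the Galois representations of cuspidal
Hilbert eigenforms, `WD(r|_{Γ_{K_v}})^{F-ss} ≅ ι⁻¹ rec_v(π_v)`, `L`-normalisation).

`…AuxFieldProofs` reduced the fact `Langlands1980_quadraticBaseChange_frobCompatible` to
Carayol's ramification clause (C) — "for `π` regular algebraic cuspidal on `GL₂` over a totally
real `K` and `r` irreducible, compatible with `π` at every `v ∤ ℓ` where `π` is unramified: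
`r` unramified at `w ∤ ℓ` ⇒ `π` unramified at `w`" — plus lang.S27 and three base-change facts
(`Langlands1980_quadraticBaseChange_frobCompatible_of_carayol`).  This file derives (C) from the
hypothesis `hLGu` = **`galoisRep_GL2_totallyReal_localGlobal` strengthened, under its `∃ llc`, by
the unramified clause of the SAME local Langlands data**: "`rec_v(π_v)` = an unramified parameter
(`N = 0`, trivial on inertia) ⇒ `π_v` has a non-zero `GL₂(𝒪_v)`-fixed vector" (Harris–Taylor
2001, Thm. A with VII.2: `rec` is compatible with parabolic induction from unramified characters;
clause (g) of the accepted weak form `localLanglands_gl_weak`).  The accepted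
`LocalLanglandsDatum` / `IsLocalLanglandsGL` carries no such clause, and its six clauses do not pin
`rec_v` on non-generic classes (module docstring of `LocalLanglandsGL`, "Uniqueness"), so the
clause cannot be proved for an abstract datum: it must accompany the fact's own `llc` — `hLGu` is
therefore a HYPOTHESIS here (the first theorem records that it implies the fact as accepted).

* `galoisRep_GL2_totallyReal_localGlobal_of_unramifiedClause` — `hLGu` ⇒ the accepted fact.
* `isUnramifiedAt_of_isGaloisCompatibleAt_of_localGlobalUnramified` — **(C) from `hLGu`**:
  twist `π` by `|det|^{-1/2}` to the `L`-algebraic `π₁` (regular infinity type,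
  `CuspidalAutomorphicRepData.exists_twist_hasInfinityType`, `isLAlgebraic_twist_of_isCAlgebraic`);
  every-unramified-place `C`-normalised compatibility of `r` with `π` is almost-everywhere
  `L`-normalised compatibility with `π₁` (`HasSatakeParamAt.of_map_mulChar_detTwist_of_cpow`,
  `arithFrobPolyOfSatake_one_map_cpow_half_two`, Flath's `hasSatakeParamAt_cofinite_holds`); at
  `w ∤ ℓ` with `r` unramified, `hLGu` gives the local component `π₁,w` and
  `rec_w(π₁,w) = ⟦WD(r|_{Γ_{K_w}})^{F-ss}⟧`, an UNRAMIFIED parameter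
  (`FramedGaloisRep.exists_frobSemisimple_unramified_of_isUnramifiedAt`,
  `WeilDeligneOfGaloisUnramifiedProofs`), so `π₁,w` is spherical (the unramified clause), so `π₁`
  is unramified at `w` (`AutomorphicRepData.isUnramifiedAt_of_hasLocalComponentAt_of_mem_fixedPoints`,
  `LocalComponentBJUnramifiedProofs`), so `π` is (`isUnramifiedAt_iff_of_twist`).
* `Langlands1980_quadraticBaseChange_frobCompatible_of_localGlobalUnramified` — the fact from
  `hLGu`, lang.S27 (`exists_galoisRep_of_regularAlgebraic`), `ArthurClozel1989_strongLifting_archimedean`,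
  `baseChange_cyclic_cuspidal`, `ArthurClozel1989_strongLifting_unramified`.

## References

* C. Skinner, Doc. Math. 14 (2009) 241–258, (1) p. 242. [Skinner2009]
* H. Carayol, Ann. Sci. ÉNS 19 (1986) 409–468, Thm. (A). [CarayolASENS1986]
* M. Harris, R. Taylor, Ann. of Math. Stud. 151 (2001), Thm. A, VII.2. [HarrisTaylorAMS2001]
* R. P. Langlands, *Base change for GL(2)*, Ann. of Math. Stud. 96 (1980), §2. [LanglandsBaseChange1980]
* K. Buzzard, T. Gee, LMS Lecture Note Ser. 414 (2014), §5.3. [BuzzardGeeLMS2014]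
-/

noncomputable section

open scoped MatrixGroups Matrix NumberField
open NumberField IsDedekindDomain Field Filter Polynomial

namespace Literature.NumberTheory.Automorphic

open Literature.NumberTheory.GaloisRepresentations

/-! ### Bookkeeping: the inverse half twist -/

section Bookkeeping

variable {n : ℕ} {K : Type} [Field K] [NumberField K] {ℓ : ℕ} [Fact ℓ.Prime]

omit [NumberField K] in
/-- A `C`-algebraic infinity type twisted by `|det|^{-(n-1)/2}` is `L`-algebraic (exponents
`(n-1)/2 + ℤ` become integers). Buzzard–Gee 2014, §5.3. [cite: BuzzardGeeLMS2014, §5.3] -/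
theorem InfinityType.isLAlgebraic_twist_of_isCAlgebraic {T : InfinityType K n} (h : T.IsCAlgebraic)
    {c : ℂ} (hc : c = -(((n : ℂ) - 1) / 2)) : (T.twist c).IsLAlgebraic := by
  subst hc
  simp only [InfinityType.IsLAlgebraic, InfinityType.twist_apply, Multiset.forall_mem_map_iff,
    ArchWeight.twist_a, ArchWeight.twist_b]
  intro σ p hp
  obtain ⟨k, l, hk, hl⟩ := h σ p hp
  exact ⟨k, l, by rw [hk]; ring, by rw [hl]; ring⟩

/-- **`m = 1` on the parameter of the inverse half twist is `m = 2` on the parameter** (`GL₂`):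
`arithFrobPolyOfSatake ι q 1 (q^{1/2} · β) = arithFrobPolyOfSatake ι q 2 β` (both are
`∏_{b ∈ β} (X - ι⁻¹((√q b)⁻¹))`), the exponent being written `-(-((2-1)/2))` as produced by
`HasSatakeParamAt.of_map_mulChar_detTwist_of_cpow` for the twist by `|det|^{-1/2}`.
Buzzard–Gee 2014, §2.1 and §5.3. [cite: BuzzardGeeLMS2014, §2.1 and §5.3] -/
theorem arithFrobPolyOfSatake_one_map_cpow_half_two (ι : PadicAlgCl ℓ ≃+* ℂ) (q : ℕ)
    (β : Multiset ℂ) :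
    arithFrobPolyOfSatake ι q 1
        (β.map (((q : ℂ) ^ (-(((-(((2 : ℝ) - 1) / 2) : ℝ) : ℂ)))) * ·)) =
      arithFrobPolyOfSatake ι q 2 β := by
  have hq0 : (0 : ℝ) ≤ q := Nat.cast_nonneg q
  have hE : (q : ℂ) ^ (-(((-(((2 : ℝ) - 1) / 2) : ℝ) : ℂ))) = ((Real.sqrt q : ℝ) : ℂ) ^ (2 - 1) := by
    rw [show (2 - 1 : ℕ) = 1 from rfl, pow_one, Real.sqrt_eq_rpow,
      show (q : ℂ) = ((q : ℝ) : ℂ) by norm_cast, ← Complex.ofReal_neg, ← Complex.ofReal_cpow hq0]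
    congr 1
    norm_num
  rw [arithFrobPolyOfSatake, arithFrobPolyOfSatake, Multiset.map_map]
  congr 1
  refine Multiset.map_congr rfl fun a _ ↦ ?_
  simp only [Function.comp_apply, hE, Nat.sub_self, pow_zero, one_mul]

/-- The finitely many places above `ℓ` are avoided almost everywhere. [folklore] -/
private theorem eventually_natCast_not_mem_asIdeal₅ :
    ∀ᶠ v : HeightOneSpectrum (𝓞 K) in cofinite, ((ℓ : ℕ) : 𝓞 K) ∉ v.asIdeal := by
  have hne : Ideal.span {((ℓ : ℕ) : 𝓞 K)} ≠ ⊥ := by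
    rw [Ne, Ideal.span_singleton_eq_bot]
    exact_mod_cast (Fact.out : ℓ.Prime).ne_zero
  refine Filter.mem_of_superset (Ideal.finite_factors hne).compl_mem_cofinite ?_
  intro v hv hmem
  exact hv (Ideal.dvd_span_singleton.2 hmem)

end Bookkeeping

/-! ### (C) from local–global compatibility with the unramified clause -/

section LocalGlobal

/- The hypothesis `hLGu`: the accepted named fact `galoisRep_GL2_totallyReal_localGlobal`
(Carayol 1986 Thm. (A); Taylor 1989; Blasius–Rogawski 1993; Skinner 2009 (1) p. 242 and Thm. 1),
verbatim, with ONE extra conjunct under its `∃ llc`: the unramified clause of the local Langlands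
correspondence for the same data `llc v` (Harris–Taylor 2001, Thm. A with VII.2) — an
irreducible smooth `πv` whose parameter `rec_v(πv)` is unramified (`N = 0`, trivial on inertia)
has a non-zero `GL₂(𝒪_v)`-fixed vector.  Not a named fact of the tree; see the module docstring. -/
variable
  (hLGu : ∀ (K : Type) [Field K] [NumberField K], IsTotallyReal K →
    ∃ llc : ∀ v : HeightOneSpectrum (𝓞 K), LocalLanglandsDatum (v.adicCompletion K),
      (∀ (v : HeightOneSpectrum (𝓞 K)) (πv : SmoothIrrep (GL (Fin 2) (v.adicCompletion K)))
          (r' : WeilDeligneRep (v.adicCompletion K) ℂ (Fin 2 → ℂ)) (hr' : r'.IsFrobSemisimple),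
          r'.N = 0 → WeilGroup.IsUnramifiedRep r'.ρ →
          (llc v).recGL 2 (IrrClass.mk πv) =
            Quotient.mk (frobSemisimpleWDSetoid (v.adicCompletion K) 2) ⟨r', hr'⟩ →
          ∃ x : πv.V, x ≠ 0 ∧
            x ∈ πv.ρ.fixedPoints (valuedCongruenceSubgroup (Fin 2) (1 : WithZero (Multiplicative ℤ)))) ∧
      ∀ (hcpt : isCompact_glFiniteIntegralLevel 2 K) (π : CuspidalAutomorphicRepData 2 K hcpt),
        π.1.IsLAlgebraic → (∃ T : InfinityType K 2, π.1.HasInfinityType T ∧ T.IsRegular) →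
        ∀ (ℓ : ℕ) [Fact ℓ.Prime] (ι : PadicAlgCl ℓ ≃+* ℂ) (r : FramedGaloisRep K (PadicAlgCl ℓ) 2),
          r.toGaloisRep.IsIrreducible → SatakeFrobCompatibleAE ι π.1 r →
          (∀ (v : HeightOneSpectrum (𝓞 K)) (hv : ((ℓ : ℕ) : 𝓞 K) ∈ v.asIdeal),
              (PAdicHodge.fontainePstAdicCompletion v ℓ hv).IsDeRhamFramed (r.toLocal v)) ∧
          ∀ v : HeightOneSpectrum (𝓞 K),
            ∃ (πv : SmoothIrrep (GL (Fin 2) (v.adicCompletion K)))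
              (rv : WeilDeligneRep (v.adicCompletion K) (PadicAlgCl ℓ) (Fin 2 → PadicAlgCl ℓ))
              (rℂ : WeilDeligneRep (v.adicCompletion K) ℂ (Fin 2 → ℂ)),
              π.1.HasLocalComponentAt v πv.ρ ∧
              (((ℓ : ℕ) : 𝓞 K) ∉ v.asIdeal →
                IsWeilDeligneOfLadic (r.toLocal v).toWeilGroupHom rv) ∧
              (∀ hv : ((ℓ : ℕ) : 𝓞 K) ∈ v.asIdeal,
                (PAdicHodge.fontainePstAdicCompletion v ℓ hv).IsWeilDeligneOf (r.toLocal v) rv) ∧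
              rv.IsTransportAlong (ι : PadicAlgCl ℓ →+* ℂ) rℂ ∧
              rℂ.HasFrobSemisimpleClass ((llc v).recGL 2 (IrrClass.mk πv)))

include hLGu in
/-- The strengthened hypothesis implies the accepted named fact
`galoisRep_GL2_totallyReal_localGlobal` (drop the unramified clause). [cite: Skinner2009, (1) p. 242] -/
theorem galoisRep_GL2_totallyReal_localGlobal_of_unramifiedClause :
    galoisRep_GL2_totallyReal_localGlobal := by
  intro K _ _ hK
  obtain ⟨llc, -, h⟩ := hLGu K hK
  exact ⟨llc, h⟩

include hLGu in
/-- **Carayol's ramification clause (C) from local–global compatibility with the unramified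
clause.**  `K` totally real, `π` a regular algebraic cuspidal representation of `GL₂(𝔸_K)`, `ℓ`
prime, `ι : ℚ̄_ℓ ≃ ℂ`, `r : Γ_K → GL₂(ℚ̄_ℓ)` continuous irreducible and compatible with `π`
(`C`-normalisation) at every `v ∤ ℓ` where `π` is unramified; then at every finite `w ∤ ℓ` where
`r` is unramified, `π` is unramified.  Proof in the module docstring: inverse half twist, the
strengthened fact at `w`, `WD` of an unramified representation is an unramified parameter, the
unramified clause, the Borel–Jacquet dictionary, untwist.
[cite: CarayolASENS1986, Thm. (A) (pp. 410–411)] [cite: Skinner2009, (1) p. 242]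
[cite: HarrisTaylorAMS2001, Thm. A] -/
theorem isUnramifiedAt_of_isGaloisCompatibleAt_of_localGlobalUnramified
    {K : Type} [Field K] [NumberField K] (hcpt : isCompact_glFiniteIntegralLevel 2 K)
    (hK : IsTotallyReal K) (π : CuspidalAutomorphicRepData 2 K hcpt) (hreg : π.1.IsRegularAlgebraic)
    (ℓ : ℕ) [Fact ℓ.Prime] (ι : PadicAlgCl ℓ ≃+* ℂ) (r : FramedGaloisRep K (PadicAlgCl ℓ) 2)
    (hirr : r.toGaloisRep.IsIrreducible)
    (hcomp : ∀ v : HeightOneSpectrum (𝓞 K), ((ℓ : ℕ) : 𝓞 K) ∉ v.asIdeal →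
      IsGaloisCompatibleAt π.1 ι r v)
    (w : HeightOneSpectrum (𝓞 K)) (hw : ((ℓ : ℕ) : 𝓞 K) ∉ w.asIdeal) (hur : r.IsUnramifiedAt w) :
    π.1.IsUnramifiedAt w := by
  obtain ⟨T, hT, hC, hTreg⟩ := hreg
  -- the inverse half twist `π₁ = π ⊗ |det|^{-1/2}`: `L`-algebraic with a regular infinity type
  obtain ⟨χ, π₁, hχ, hW, hW', hT₁⟩ := π.exists_twist_hasInfinityType (-(((2 : ℝ) - 1) / 2)) hT
  have e : (((-(((2 : ℝ) - 1) / 2) : ℝ)) : ℂ) = -((((2 : ℕ) : ℂ) - 1) / 2) := by push_cast; ring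
  have hL₁ : π₁.1.IsLAlgebraic :=
    ⟨_, hT₁, InfinityType.isLAlgebraic_twist_of_isCAlgebraic hC e⟩
  have hreg₁ : ∃ T' : InfinityType K 2, π₁.1.HasInfinityType T' ∧ T'.IsRegular :=
    ⟨_, hT₁, hTreg.twist _⟩
  -- every-unramified-place `C`-compatibility with `π` is a.e. `L`-compatibility with `π₁`
  have hae : SatakeFrobCompatibleAE ι π₁.1 r := by
    have h1 : ∀ᶠ v : HeightOneSpectrum (𝓞 K) in cofinite, π.1.IsUnramifiedAt v :=
      π.1.hasSatakeParamAt_cofinite_holds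
    have h2 : ∀ᶠ v : HeightOneSpectrum (𝓞 K) in cofinite, ((ℓ : ℕ) : 𝓞 K) ∉ v.asIdeal :=
      eventually_natCast_not_mem_asIdeal₅
    filter_upwards [h1, h2] with v ⟨β, hβ⟩ hv
    obtain ⟨hurv, hch⟩ := hcomp v hv β hβ
    refine ⟨_, AutomorphicRepData.HasSatakeParamAt.of_map_mulChar_detTwist_of_cpow hχ hW hW' hβ,
      hurv, ?_⟩
    rwa [arithFrobPolyOfSatake_one_map_cpow_half_two ι v.residueCard]
  -- local–global compatibility for `π₁` at `w`: `rec_w(π₁,w)` is the class of an unramified `r'`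
  obtain ⟨llc, hU, hllc⟩ := hLGu K hK
  obtain ⟨-, hall⟩ := hllc hcpt π₁ hL₁ hreg₁ ℓ ι r hirr hae
  obtain ⟨πv, rv, rℂ, hloc, hWD, -, hTr, hcl⟩ := hall w
  obtain ⟨r', hr', h1, h2, h3⟩ :=
    r.exists_frobSemisimple_unramified_of_isUnramifiedAt hur (ι : PadicAlgCl ℓ →+* ℂ) (hWD hw)
      hTr hcl
  -- the unramified clause: `π₁,w` is spherical; Borel–Jacquet dictionary; untwist
  obtain ⟨x, hx0, hxK⟩ := hU w πv r' hr' h2 h3 h1.symm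
  have hπ₁ : π₁.1.IsUnramifiedAt w :=
    π₁.1.isUnramifiedAt_of_hasLocalComponentAt_of_mem_fixedPoints w πv hloc hx0 hxK
  exact (isUnramifiedAt_iff_of_twist hχ hW hW' w).mp hπ₁

include hLGu in
/-- **`Langlands1980_quadraticBaseChange_frobCompatible` from local–global compatibility with the
unramified clause and the base-change facts.**  Granted `hLGu` (module docstring), lang.S27
(`exists_galoisRep_of_regularAlgebraic`), `ArthurClozel1989_strongLifting_archimedean`,
`baseChange_cyclic_cuspidal` and `ArthurClozel1989_strongLifting_unramified`, the named fact of
`QuadraticBaseChangeFrobCompatible` holds: (C) is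
`isUnramifiedAt_of_isGaloisCompatibleAt_of_localGlobalUnramified`, and
`Langlands1980_quadraticBaseChange_frobCompatible_of_carayol` (`…AuxFieldProofs`) does the rest.
[cite: LanglandsBaseChange1980, §2 (A), (F), pp. 19–20] [cite: CarayolASENS1986, Thm. (A)]
[cite: ArthurClozelAMS120, Ch. 3 Thm. 4.2 and Thm. 5.1] -/
theorem Langlands1980_quadraticBaseChange_frobCompatible_of_localGlobalUnramified
    (h27 : exists_galoisRep_of_regularAlgebraic) (hArch : ArthurClozel1989_strongLifting_archimedean)
    (hBCc : baseChange_cyclic_cuspidal) (hACu : ArthurClozel1989_strongLifting_unramified) :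
    Langlands1980_quadraticBaseChange_frobCompatible :=
  Langlands1980_quadraticBaseChange_frobCompatible_of_carayol
    (isUnramifiedAt_of_isGaloisCompatibleAt_of_localGlobalUnramified hLGu) h27 hArch hBCc hACu

end LocalGlobal

end Literature.NumberTheory.Automorphic

end
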